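import Summits.QuantumFields.YangMills.Theorems.LuscherReductionTwistedTraceScalingGnomonicKinetic
import Summits.QuantumFields.YangMills.Theorems.LuscherReductionTwistedTraceScalingElectricSplit
import HarnessLib

/-!
# The kinetic factor of the `L³` transfer kernel in the lattice GNOMONIC chart: a two-sided Gaussian sandwich
# `e^{2β|E|}·e^{−βΣ_e|w_e−w'_e|²} ≤ latE(P(w),P(w')) ≤ e^{2β|E|}·e^{−βΣ_e|w_e−w'_e|²/((1+ρ²)²)}` for `|w_e|², |w'_e|² ≤ ρ²`
# (lane B of S-BASE, crux `TwistedTraceScaling` stmt-QuantumFields-20203; the Laplace step of both COARSE lanes, in the chart of `…LatticeGnChart`)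

Sum over links of `…GnomonicKinetic.frobNorm_gnoPoint_sub_sq_sandwich` inside `…ElectricSplit.latE_eq_exp_frobSq`, on the vacuum pattern
`latPatternChart L (fun _ ↦ false) w` (every link `P(1,w_e)`).  HONEST FRAMING: bookkeeping; femto rung R2b1; not a gap, not Clay.
-/

set_option autoImplicit false

noncomputable section

open scoped BigOperators
open Literature.MathematicalPhysics.QuantumFieldTheory
open Literature.MathematicalPhysics.QuantumLattice
open Literature.MathematicalPhysics.QuantumFieldTheory.Balaban1983to89.T4CubeChartGnomonic (gnoPoint)

namespace Summit.QuantumFields.YangMills.Theorems.FemtoTransferGap.TwoLattice.GnChart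

open Summit.QuantumFields.YangMills.Theorems.FemtoTransferGap
open Summit.QuantumFields.YangMills.Theorems.FemtoTransferGap.TwoLattice

variable (L : ℕ) [NeZero L]

/-- ★ **Lattice kinetic sandwich in gnomonic coordinates** (vacuum pattern): for `β ≥ 0` and coordinates with `Σ_a w_e a² ≤ ρ²`, `Σ_a w'_e a² ≤ ρ²`
on every link,
`e^{2β|E|}·exp(−β Σ_e Σ_a (w_e a − w'_e a)²) ≤ latE L β (P w) (P w') ≤ e^{2β|E|}·exp(−(β/(1+ρ²)²) Σ_e Σ_a (w_e a − w'_e a)²)`. [folklore] -/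
theorem latE_gnomonic_sandwich {β : ℝ} (hβ : 0 ≤ β) {ρ : ℝ} (w w' : Edge 3 L → Fin 3 → ℝ)
    (hw : ∀ e, ∑ a, w e a ^ 2 ≤ ρ ^ 2) (hw' : ∀ e, ∑ a, w' e a ^ 2 ≤ ρ ^ 2) :
    Real.exp (2 * β) ^ Fintype.card (Edge 3 L) * Real.exp (-(β * ∑ e : Edge 3 L, ∑ a, (w e a - w' e a) ^ 2)) ≤
        latE L β (latPatternChart L (fun _ => false) w) (latPatternChart L (fun _ => false) w') ∧
      latE L β (latPatternChart L (fun _ => false) w) (latPatternChart L (fun _ => false) w') ≤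
        Real.exp (2 * β) ^ Fintype.card (Edge 3 L) *
          Real.exp (-(β / (1 + ρ ^ 2) ^ 2 * ∑ e : Edge 3 L, ∑ a, (w e a - w' e a) ^ 2)) := by
  rw [Electric.latE_eq_exp_frobSq]
  simp only [latPatternChart_false]
  have hρA : ∀ e, (1 + ∑ a, w e a ^ 2) * (1 + ∑ a, w' e a ^ 2) ≤ (1 + ρ ^ 2) ^ 2 := fun e => by
    have h1 := hw e; have h2 := hw' e
    have h0 : 0 ≤ ∑ a, w e a ^ 2 := Finset.sum_nonneg fun a _ => sq_nonneg _
    have h0' : 0 ≤ ∑ a, w' e a ^ 2 := Finset.sum_nonneg fun a _ => sq_nonneg _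
    nlinarith
  have hpos : 0 < (1 + ρ ^ 2) ^ 2 := by positivity
  constructor
  · refine mul_le_mul_of_nonneg_left (Real.exp_le_exp.2 ?_) (by positivity)
    -- `(β/2)Σ‖ΔP‖² ≤ β Σ|Δw|²`
    have h : ∑ e : Edge 3 L, frobNorm ((gnoPoint (w e) : Matrix (Fin 2) (Fin 2) ℂ) - (gnoPoint (w' e) : Matrix (Fin 2) (Fin 2) ℂ)) ^ 2 ≤
        ∑ e : Edge 3 L, 2 * ∑ a, (w e a - w' e a) ^ 2 :=
      Finset.sum_le_sum fun e _ => (frobNorm_gnoPoint_sub_sq_sandwich (w e) (w' e)).2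
    rw [← Finset.mul_sum] at h
    nlinarith
  · refine mul_le_mul_of_nonneg_left (Real.exp_le_exp.2 ?_) (by positivity)
    -- `β/(1+ρ²)² Σ|Δw|² ≤ (β/2)Σ‖ΔP‖²`
    have h : ∀ e : Edge 3 L, 2 * ∑ a, (w e a - w' e a) ^ 2 ≤
        (1 + ρ ^ 2) ^ 2 * frobNorm ((gnoPoint (w e) : Matrix (Fin 2) (Fin 2) ℂ) - (gnoPoint (w' e) : Matrix (Fin 2) (Fin 2) ℂ)) ^ 2 :=
      fun e => ((frobNorm_gnoPoint_sub_sq_sandwich (w e) (w' e)).1).trans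
        (mul_le_mul_of_nonneg_right (hρA e) (sq_nonneg _))
    have hs : 2 * ∑ e : Edge 3 L, ∑ a, (w e a - w' e a) ^ 2 ≤
        (1 + ρ ^ 2) ^ 2 * ∑ e : Edge 3 L, frobNorm ((gnoPoint (w e) : Matrix (Fin 2) (Fin 2) ℂ) - (gnoPoint (w' e) : Matrix (Fin 2) (Fin 2) ℂ)) ^ 2 := by
      rw [Finset.mul_sum, Finset.mul_sum]; exact Finset.sum_le_sum fun e _ => h e
    have h0 : 0 ≤ ∑ e : Edge 3 L, ∑ a, (w e a - w' e a) ^ 2 := Finset.sum_nonneg fun e _ => Finset.sum_nonneg fun a _ => sq_nonneg _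
    -- goal: `β/(1+ρ²)² · Σ|Δw|² ≤ (β · Σ‖ΔP‖²)/2`
    have hkey : β / (1 + ρ ^ 2) ^ 2 * ∑ e : Edge 3 L, ∑ a, (w e a - w' e a) ^ 2 ≤
        (β * ∑ e : Edge 3 L, frobNorm ((gnoPoint (w e) : Matrix (Fin 2) (Fin 2) ℂ) - (gnoPoint (w' e) : Matrix (Fin 2) (Fin 2) ℂ)) ^ 2) / 2 := by
      rw [div_mul_eq_mul_div, div_le_iff₀ hpos]
      have h3' : β * (2 * ∑ e : Edge 3 L, ∑ a, (w e a - w' e a) ^ 2) ≤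
          β * ((1 + ρ ^ 2) ^ 2 * ∑ e : Edge 3 L, frobNorm ((gnoPoint (w e) : Matrix (Fin 2) (Fin 2) ℂ) - (gnoPoint (w' e) : Matrix (Fin 2) (Fin 2) ℂ)) ^ 2) :=
        mul_le_mul_of_nonneg_left hs hβ
      nlinarith [h3']
    have h3 : β * (2 * ∑ e : Edge 3 L, ∑ a, (w e a - w' e a) ^ 2) ≤
        β * ((1 + ρ ^ 2) ^ 2 * ∑ e : Edge 3 L, frobNorm ((gnoPoint (w e) : Matrix (Fin 2) (Fin 2) ℂ) - (gnoPoint (w' e) : Matrix (Fin 2) (Fin 2) ℂ)) ^ 2) :=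
      mul_le_mul_of_nonneg_left hs hβ
    linarith [hkey]

end Summit.QuantumFields.YangMills.Theorems.FemtoTransferGap.TwoLattice.GnChart

end
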